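import Mathlib
import Literature.MathematicalPhysics.QuantumFieldTheory.Balaban1983to89.Setup

/-!
# `Balaban1983to89.B12` — T. Bałaban, *Renormalization group approach to lattice gauge field theories. I.
Generation of effective actions in a small field approximation and a coupling constant renormalization in
four dimensions*, Commun. Math. Phys. **109**, 249–301 (1987), doi:10.1007/bf01215223.  (Cell numbering: B12 = "[I]"
of the later papers B13–B16.)  PDF held: `paper:balaban1987-cmp109-rg-i-small-field` (journal page = PDF page + 248).

CITATION HEADER (lean-in-tree rule 2026-08-18).  This module is a TYPED SKELETON (statement level) of §0–§1 of the
published paper [Balaban1987RG1] (cell paper B12).  WHAT IS REPRODUCED: Theorem 1 (p. 259), Theorem 2 (p. 259, (0.31)),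
Theorem 3 (p. 264), the representation (0.22) and the ε-uniform bound (0.30) (pp. 256–259), each as a `def … : Prop`
whose docstring carries the VERBATIM printed statement (journal page [PDF page]) with the ORDER OF QUANTIFIERS made
explicit; plus two pieces of kernel-checked bookkeeping (`thm1_of_thm3_fixedConsts`, `interval_automatic_d3`).
NOTHING of the series is asserted.  In particular **Theorem 2 is STATED WITHOUT PROOF in print** ("A proof of this
theorem, based on perturbative calculations, will be given in a separate paper"; [Balaban1989LargeFieldII] p. 355
(1989): "has not been published yet"; no later publication by the author is known to the audit cell) — it is a CLAIM
UNDER ADJUDICATION, typed here (`Thm2Printed`) only so that other modules can take it as an explicit hypothesis.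
The series' end-statement is conditional on its conclusion (see `…Balaban1983to89.B16`).  §§2–5 of the paper (the
expansions, Ward–Takahashi identities, β-function extraction (1.22)) are not typed here; the detailed inductive
assumptions (1.1)–(1.22) are ONE abstract predicate per step (`RunData.IndAss`), their clause-by-clause content being
the business of the cell's `Step` module.

Vocabulary: imports the cell's shared `Setup` and uses its `Flow` (couplings `g_k`, β-functions), `Flow.SatisfiesRG`
((0.18)/(0.20)) and `Flow.InInterval` (the standing hypothesis `0 < g_k ≤ γ`).  Why two small LOCAL carriers
(`RunParams`, `RunData`) and not more of `Setup`: the theorems of this paper are statements about a whole FAMILY of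
lattice approximations — "uniform in the lattice spacing ε" (p. 259), "g₀ = g₀(ε, g)" (Thm 2) — so the construction
is read as a MAP `Construction := RunParams → RunData` from the parameters that VARY in the continuum limit (`K`
with `ε = L^{-K}`, the torus exponent `m`, the bare coupling `g₀`) to statement-level data, while `d = 4`, the group
`G ⊂ U(N)`, the block size `L` and all construction constants are FIXED inside the map.  `Setup.Params` (d, L, m, K
with side conditions) describes ONE approximation and carries the fixed `d`, `L`; quantifying Thm 1–3 over it would
wrongly let `γ` depend on (or vary with) `d`, `L`.  `Setup.UVStableBound` is the bound (0.30) for ONE approximation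
over concrete gauge fields; `UVStable030` below is its family version (ONE constant for all runs), which is what
"uniform in the lattice spacing ε" (p. 259) says.  No `Setup` definition is restated.  Reused downstream: `…B13`,
`…B14`, `…B16` import this module for `RunParams`/`RunData`/`Construction`/`Thm2Printed`.
Staged byte-identically in the cell package `run/shared/lean/pub/pub-balaban/lean/BalabanYm4/Literature/…/B12.lean`
(legacy Mathlib-only copy `BalabanYm4/B12.lean` there, namespace `BalabanYm4.B12`, same statements over a raw
`g`/`β` pair instead of `Flow`).  Unit `b2b-balaban-r2` (reader group B+C); companion prose `HOME/b2b-balaban-r2/B12.md`,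
`HOME/FINAL-STATEMENT.md`; census rows GAPS.md G1, G3, G-r2.1, G-r2.3; quantifier-order decision DIVERGENCE.md D-r2.3.

Scope sentences, VERBATIM.  p. 259 [11], between Theorem 1 and Theorem 2: "The above theorem will be reformulated
more elaborately in the next section. It will be proved in this paper for an arbitrary semisimple compact Lie group
G ⊂ U(N), and for d = 4. The proof also covers the dimension d = 3, but in that case it is not necessary to consider
the β-functions and the renormalization group equations (0.18), (0.20). The effective coupling constants are given by
g_k² = g²L^kε; hence the assumption of the above theorem is satisfied for g sufficiently small. The problem of whether
the assumption is satisfied in dimension d = 4 is addressed in the next theorem."  (The print announces the SCOPE OF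
THE PROOF given in the paper — "It will be proved in this paper for …"; it is not a separately asserted validity
claim.)  p. 252 [4]: "In this paper we are interested mainly in d = 4 gauge field theories. We do all considerations,
and write all formulas below for this case, and only occasionally we discuss some special features of d = 3."
p. 251 [3]: "We take L_μ = L^m, where L is an odd, positive integer > 11, and m is a positive integer."; "with a
lattice spacing ε = L^{−K}."

Typographic convention of this module (all quotations): the print's ≦ / ≧ are rendered ≤ / ≥ and its bold-face E, V, D
as 𝐄, 𝐕, 𝐃 (plain `E_k` only inside code identifiers); "p. n [m]" = journal page n, PDF page m of the held scan.
DOCFIX (unit `b2b-balaban-b12-g7`, 2026-08-18; GAPS.md G-ref2-18 (b) and C-b12g7-1; full quotation audit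
`HOME/b2b-balaban-b12-g7/XAUDIT-B12lean.md`, 55 loci against the page images): DOCSTRINGS ONLY — the two paraphrases
that stood inside quotation marks in this paragraph (p. 259, p. 252) replaced by the printed sentences; five compressed
glosses re-quoted to the printed words (`RunData`, `Construction`, `CubeCover`, `Bound027Printed`); three reading
labels taken out of quotation marks (`Thm2Printed`, `Thm3Printed`, module text); bold 𝐄 restored in the (0.22)/(0.30)
quotations; two locators widened (Thm 2 → pp. 259–260; "[39–44, 25, 26]" → pp. 256–257).  No declaration changed.
-/

namespace Literature.MathematicalPhysics.QuantumFieldTheory.Balaban1983to89.B12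

open Literature.MathematicalPhysics.QuantumFieldTheory.Balaban1983to89

/-- Parameters of ONE lattice approximation, i.e. the quantities VARIED in the continuum / infinite-volume
directions at fixed `d`, `G`, `L` and fixed construction constants (p. 251 (0.1); pp. 255–256 (0.17)–(0.20)):
`K` = number of renormalization steps (initial spacing `ε = L^{-K}`, final lattice = unit lattice), `m` = torus
exponent (`L_μ = L^m`), `g0` = bare coupling constant.  (`Setup.Params` = (d, L, m, K) describes one approximation
including the fixed d, L; see the module docstring.) [cite: Balaban1987RG1, §0 (0.1) p.251 and (0.17)–(0.20) pp.255–256] -/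
structure RunParams where
  K : ℕ
  m : ℕ
  g0 : ℝ

/-- Statement-level data of the small-field construction for one run.  `flow` = the effective couplings `g_k`
and β-functions `β_k(·)` of (0.18)/(0.20) and (1.22) (a `Setup.Flow`); `Cfg k` = unit-lattice configurations `V`
at step `k` (on `T_1^{(k)}`); `dom k` = the small-field domain ("|∂U_k(V) − 1| < ε₀ η² on T_η", p. 259);
`effAction k V` = `A_k(g_k, V)`; `wilsonBG k V` = `A^η(U_k(V))`, the Wilson action (0.2) of the minimal
configuration `U_k(V)` of [Balaban1985Variational] Thm 1; `Ek k V` = `E_k(U_k(V))` of (0.22)–(0.23);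
`numSites k` = `|T_1^{(k)}|` (in the model: `Fintype.card (Setup.Site P k) = (2L^{m+K-k})^d`);
`Repr k` = Thm 1's conclusion read at step k: the effective action A_k is "given by the formulas (0.22)–(0.24), with
terms satisfying (0.29)" (p. 259); `IndAss k` = Thm 3's conclusion read at step k: A_k satisfies "all the inductive
assumptions described between (1.1)–(1.22)" (p. 264; clause content = the cell's `Step` module). [cite: Balaban1987RG1, (0.17)–(0.24) pp.255–257] -/
structure RunData where
  flow : Flow
  Cfg : ℕ → Type
  dom : (k : ℕ) → Set (Cfg k)
  effAction : (k : ℕ) → Cfg k → ℝ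
  wilsonBG : (k : ℕ) → Cfg k → ℝ
  Ek : (k : ℕ) → Cfg k → ℝ
  numSites : ℕ → ℕ
  Repr : ℕ → Prop
  IndAss : ℕ → Prop

/-- The whole construction read as a map: run parameters ↦ data (Thm 3 p. 264 "There exist positive constants … such,
that" = the choice of one `Construction`; "The constant γ depends on all other constants." = γ is chosen after it). [cite: Balaban1987RG1, Thm 3 p.264] -/
def Construction : Type 1 := RunParams → RunData

/-- **(0.22)** p. 256 [8], verbatim: *"A_k(g_k, V) = A_k(g_k, U_k(V)) = −(1/g_k²) A^η(U_k(V)) + 𝐄_k(U_k(V))"* on the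
small-field domain (`Setup.EffActionSeq.Representation` is the same identity for ONE approximation over concrete
gauge fields). [cite: Balaban1987RG1, (0.22) p.256] -/
def Repr022 (D : RunData) (k : ℕ) : Prop :=
  ∀ V, V ∈ D.dom k → D.effAction k V = -(1 / (D.flow.g k) ^ 2) * D.wilsonBG k V + D.Ek k V

/-- **(0.30)** p. 258 [10], verbatim: *"|𝐄_k(U_k)| ≤ Σ_{j=1}^{k} Σ_{X∈𝐃_j} O(1)(L^jη)^{4+α} exp(−κ d_j(X)) ≤ … ≤
O(1)(1 − L^{−α})^{−1} M^{−4} |T_1^{(k)}|"*, and p. 259 [11]: *"For the effective action corresponding to the unit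
lattice, where k = K = log_L 1/ε, the above bound is uniform in the lattice spacing ε. This is the essence of the
ultraviolet stability concept"*.  Typed with ONE constant `Cst` chosen before the run — the family version of
`Setup.UVStableBound` (which is (0.30) for one approximation). [cite: Balaban1987RG1, (0.30) pp.258–259] -/
def UVStable030 (C : Construction) (γ Cst M : ℝ) : Prop :=
  ∀ P : RunParams, (C P).flow.InInterval γ P.K → ∀ k, k ≤ P.K → ∀ V, V ∈ (C P).dom k →
    |(C P).Ek k V| ≤ Cst * M⁻¹ ^ 4 * ((C P).numSites k : ℝ)

/-- **Theorem 1**, verbatim (p. 259 [11]): *"If the sequence of the effective coupling constants is contained in an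
interval ]0, γ] with a sufficiently small positive γ, then the effective actions for small fields are given by the
formulas (0.22)–(0.24), with terms satisfying (0.29)."*  (p. 264: "Now we can formulate a precise version of
Theorem 1." = Theorem 3.)  Reading: ∃ γ > 0 (after all construction constants) ∀ runs with `0 < g_k ≤ γ`, `k ≤ K`
(`Setup.Flow.InInterval`), ∀ k ≤ K, `Repr k`. [cite: Balaban1987RG1, Thm 1 p.259] -/
def Thm1Printed (C : Construction) : Prop :=
  ∃ γ : ℝ, 0 < γ ∧ ∀ P : RunParams, (C P).flow.InInterval γ P.K → ∀ k, k ≤ P.K → (C P).Repr k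

/-- **Theorem 2**, verbatim (pp. 259–260 [11–12]; the last sentence stands on p. 260): *"Let d = 4, G = SU(2), and
let γ be a sufficiently small positive constant, then for a sufficiently small positive g there exists a bare coupling
constant g₀ = g₀(ε, g) such that the sequence of the effective coupling constants g_k is contained in the interval
]0, γ], and g_K = g. Moreover, there exist constants β, β′, 0 < β ≤ β′, such that g_k satisfy the inequality
  1/g² + β log(L^k ε)^{−1} ≤ 1/g_k² ≤ 1/g² + β′ log(L^k ε)^{−1} .   (0.31)
A proof of this theorem, based on perturbative calculations, will be given in a separate paper, where more precise
asymptotic behavior will be proved. The restriction to the group SU(2) is superficial and is done only to simplify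
calculations."*  **STATED WITHOUT PROOF — UNDER ADJUDICATION** ([Balaban1989LargeFieldII] p. 355, 1989: "has not been
published yet"); never a `theorem`, only a hypothesis downstream.  d = 4, G = SU(2) are fixed inside `C`; `L` = the
block size as a real; with `ε = L^{-K}`, `log(L^k ε)^{−1} = (K − k) log L` (so (0.31) here = `Setup.Flow.LogRunning`
after that substitution).  Quantifier placement (a recorded reading choice): the torus exponent `m` (fixed on
p. 251) outermost — print varies only ε and g ("g₀ = g₀(ε, g)") and states no T-uniformity for Thm 2; "let γ be a
sufficiently small positive constant" = ∀ γ ∈ ]0, γ₂]; "for a sufficiently small positive g" = ∀ g ∈ ]0, g⋆]; β, β′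
after (γ, g) and BEFORE `K` (else (0.31) would not be ε-uniform) and `k`; `g₀` after `K`. [cite: Balaban1987RG1, Thm 2 (0.31) p.259] -/
def Thm2Printed (C : Construction) (L : ℝ) : Prop :=
  ∀ m : ℕ, ∃ γ₂ : ℝ, 0 < γ₂ ∧ ∀ γ : ℝ, 0 < γ → γ ≤ γ₂ →
    ∃ gstar : ℝ, 0 < gstar ∧ ∀ g : ℝ, 0 < g → g ≤ gstar →
      ∃ β β' : ℝ, 0 < β ∧ β ≤ β' ∧ ∀ K : ℕ, ∃ g0 : ℝ,
        (C ⟨K, m, g0⟩).flow.InInterval γ K ∧ (C ⟨K, m, g0⟩).flow.g K = g ∧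
        ∀ k, k ≤ K →
          1 / g ^ 2 + β * (((K : ℝ) - k) * Real.log L) ≤ 1 / ((C ⟨K, m, g0⟩).flow.g k) ^ 2 ∧
          1 / ((C ⟨K, m, g0⟩).flow.g k) ^ 2 ≤ 1 / g ^ 2 + β' * (((K : ℝ) - k) * Real.log L)

/-- The constants of Theorem 3 chosen by the reader ("if κ ≥ κ₀, M ≥ M(κ)") and those asserted to exist depending
on M ("ε₀, ε₁, α₀, α₁ depend on M") — the sub-list of `Setup.Consts` that Theorem 3 quantifies explicitly. [cite: Balaban1987RG1, Thm 3 p.264] -/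
structure Consts3 where
  κ : ℝ
  M : ℝ
  ε₀ : ℝ
  ε₁ : ℝ
  α₀ : ℝ
  α₁ : ℝ

/-- **Theorem 3**, verbatim (p. 264 [16]): *"There exist positive constants κ₀, M(κ), γ, ε₀, ε₁, α₀, α₁ such, that
if κ ≥ κ₀, M ≥ M(κ), 0 < g_k ≤ γ for k = 0, 1, …, K, then the sequence of actions A_k, defined inductively by the
small field renormalization transformations (0.17)–(0.20), satisfy all the inductive assumptions described between
(1.1)–(1.22). The constants ε₀, ε₁, α₀, α₁ depend on M and satisfy numerous restrictions, which will become clear in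
the proof. The constant γ depends on all other constants."*  Typed quantifier order: ∃ κ₀; ∀ κ ≥ κ₀ ∃ M(κ); ∀ M ≥ M(κ)
∃ ε₀, ε₁, α₀, α₁ > 0 (the unlisted "numerous restrictions" are absorbed by the existential — read: some admissible choice);
∃ γ > 0 LAST; then ∀ runs.  The construction depends on the constants: `C : Consts3 → Construction`.  Printed proof =
§§2–5 of this paper + [Balaban1988RG2Cluster] (p. 22 there: "hence the proof of Theorem I.3"). [cite: Balaban1987RG1, Thm 3 p.264] -/
def Thm3Printed (C : Consts3 → Construction) : Prop :=
  ∃ κ₀ : ℝ, 0 < κ₀ ∧ ∀ κ : ℝ, κ₀ ≤ κ →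
    ∃ Mκ : ℝ, 0 < Mκ ∧ ∀ M : ℝ, Mκ ≤ M →
      ∃ ε₀ ε₁ α₀ α₁ : ℝ, 0 < ε₀ ∧ 0 < ε₁ ∧ 0 < α₀ ∧ 0 < α₁ ∧
        ∃ γ : ℝ, 0 < γ ∧ ∀ P : RunParams,
          (C ⟨κ, M, ε₀, ε₁, α₀, α₁⟩ P).flow.InInterval γ P.K →
            ∀ k, k ≤ P.K → (C ⟨κ, M, ε₀, ε₁, α₀, α₁⟩ P).IndAss k

/-- Bookkeeping: Theorem 3 is "a precise version of Theorem 1" (p. 264).  Given that the inductive assumptions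
(1.1)–(1.22) at step k contain the representation (0.22)–(0.24) with (0.29) at step k (they do, by inspection of
p. 260 (1.3)/(1.6); entered as the hypothesis `hIncl`), Thm 3 for fixed admissible constants yields Thm 1 for that
construction.  Pure logic. [folklore] -/
theorem thm1_of_thm3_fixedConsts (C : Consts3 → Construction) (c : Consts3) (γ : ℝ) (hγ : 0 < γ)
    (h3 : ∀ P : RunParams, (C c P).flow.InInterval γ P.K → ∀ k, k ≤ P.K → (C c P).IndAss k)
    (hIncl : ∀ P k, (C c P).IndAss k → (C c P).Repr k) :
    Thm1Printed (C c) :=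
  ⟨γ, hγ, fun P hP k hk => hIncl P k (h3 P hP k hk)⟩

/-- The d = 3 remark (p. 259 [11]): *"The effective coupling constants are given by g_k² = g² L^k ε; hence the
assumption of the above theorem is satisfied for g sufficiently small."* — re-derived: with `ε = L^{-K}`,
`g_k = g (L^k ε)^{1/2} ≤ g` for `k ≤ K`, `L ≥ 1`, so `g ≤ γ` gives the interval hypothesis.  Elementary real
arithmetic, no content of the series. [folklore] -/
theorem interval_automatic_d3 (L g γ : ℝ) (K : ℕ) (hL : 1 ≤ L) (hg : 0 < g) (hgγ : g ≤ γ)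
    (F : Flow) (hgk : ∀ k, k ≤ K → F.g k = g * Real.sqrt (L ^ k * (L ^ K)⁻¹)) :
    F.InInterval γ K := by
  intro k hk
  have hLpos : 0 < L := by linarith
  have hratio_pos : 0 < L ^ k * (L ^ K)⁻¹ := by positivity
  have hratio_le : L ^ k * (L ^ K)⁻¹ ≤ 1 := by
    rw [← div_eq_mul_inv, div_le_one (by positivity)]
    exact pow_le_pow_right₀ hL hk
  rw [hgk k hk]
  refine ⟨mul_pos hg (Real.sqrt_pos.mpr hratio_pos), ?_⟩
  have hs : Real.sqrt (L ^ k * (L ^ K)⁻¹) ≤ 1 := by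
    rw [show (1 : ℝ) = Real.sqrt 1 by simp]
    exact Real.sqrt_le_sqrt hratio_le
  calc g * Real.sqrt (L ^ k * (L ^ K)⁻¹) ≤ g * 1 := mul_le_mul_of_nonneg_left hs (le_of_lt hg)
    _ = g := mul_one g
    _ ≤ γ := hgγ

/-! ## Promised continuations recorded in the paper (verbatim; none is a node of the series)
* p. 251 [3]: "The analysis of the Callan-Symanzik equations, based on perturbative calculations, will be discussed
  in another paper." — no such publication known to the cell.
* p. 259 [11]: Theorem 2: "A proof of this theorem … will be given in a separate paper" — not published
  ([Balaban1989LargeFieldII] p. 355).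
* p. 260 [12]: 2-d chiral models (0.32): "therefore we will discuss them separately in the future."
* p. 264 [16]: β-functions: "is a smooth function defined on the interval [0, γ], (or analytic), uniformly bounded on
  this interval together with all derivatives. We will investigate other properties in a separate paper." — not
  found; this is what the flow inequalities (2.6) of [Balaban1988Convergent] lean on (see `…B14`).
* p. 298 [50]: "In the next paper we will construct such localizations and prove the bounds." — = [Balaban1988RG2Cluster].
-/

/-! ## Surge nodes — §0 pp. 256–259 [8–11]: the sums (0.23)–(0.24), the bounds (0.25), (0.27)–(0.29) and the two
printed chains of inequalities (0.26), (0.30)  (surge node T09.1 SHARPEN, unit `b2b-balaban-pv03`, 2026-08-18)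

WHAT IS ADDED (append-only; nothing above is changed).  (i) The family `π_j` of closed `M`-cubes and the relation "X ⊃ □"
(p. 257 [9]) as a statement-level carrier `CubeCover` over `Setup.LocDomainSys` (paper-specific refinement of NOTATION
§2.4; geometry abstracted, DIVERGENCE F5); (ii) the displayed formulas (0.23), (0.24), (0.25), (0.27), (0.28), (0.29)
and the END MEMBERS of the chains (0.26), (0.30) as `def …Printed … : Prop` with verbatim docstrings (journal page
[PDF page]); (iii) KERNEL-CHECKED BOOKKEEPING: the chains (0.26) and (0.30) are finite-sum manipulations once their two
SILENT INPUTS are displayed — (a) the tree-decay summability `Σ_{X∈𝐃_j, X⊃□} exp(−κ d_j(X)) ≤ O(1)` (third member of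
both chains; used on pp. 257–258 without reference or proof; it is the tree-graph / lattice-animal summability of the
cluster expansion literature, pp. 256–257 [8–9]: *"Such a representation arises in a natural way as a result of cluster
expansion, see [39–44, 25, 26]"* — HERE AN EXPLICIT HYPOTHESIS `hTree`, never asserted), and (b) the cube and site counts
`|π_j| = M⁻⁴ |T_1^{(j)}|`, `|T_1^{(j)}| = L^{4(k−j)} |T_1^{(k)}|` in d = 4 (fourth members; torus geometry — EXPLICIT
HYPOTHESES `hπ`, `hSites`; in the model the second is `Site.card_site_eq_mul_succ` of module `TorusGeometry`, iterated) —
theorems `sum_le_sum_cubes`, `scale_sum_le`, `chain026_holds`, `chain030_holds`; (iv) the sentence p. 258 [10]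
*"These inequalities yield a uniform bound of the sum (0.23) on the lattice T_η, i.e. the only dependence on k is
through the volume |T_η| = |T_1^{(k)}| corresponding to the scale η"* as the implication (Theorem 1's conclusion
`RunData.Repr`, unpacked into (0.23), (0.28), (0.29) for the run's §0 term data) ⇒ `UVStable030`
(`uvStable030_of_repr`, `uvStable030_of_thm1`), the uniformity of "O(1)", α, κ in the lattice approximation being an
EXPLICIT quantifier placement (constants bound before the run).  No statement of the series is asserted.
Value = typed skeleton + located silent inputs of a printed chain, NOT summit progress. -/

/-- The family `π_j` of closed `M`-cubes at scale `j` and the relation "X ⊃ □" between localization domains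
`X ∈ 𝐃_j` and cubes `□ ∈ π_j` (p. 257 [9], verbatim: *"We decompose the space T into the lattice of closed cubes of
a size M, where M = L^m, with centers at points of the lattice T_M^{(j+m)}. … We denote this family of cubes by π_j,
and the cubes by □, □′, etc. … Such a domain is a union of a connected, finite family of cubes from π_j. … The class
of all these localization domains is denoted by 𝐃_j."*), ABSTRACTED (DIVERGENCE F5: the cube geometry is not
modelled): a finite type of cubes, for each cube the finite set `{X ∈ 𝐃_j : X ⊃ □}`, and the one consequence of the
printed "Thus every localization domain X is a union of continuous space cubes from π_j." (p. 257; X nonempty being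
the reading of "a connected, finite family of cubes") that the chains (0.26)/(0.30) use — every `X` contains some cube. [cite: Balaban1987RG1, §0 p.257] -/
structure CubeCover (S : LocDomainSys) where
  /-- the cubes `□ ∈ π_j` -/
  Cube : Type
  [fin : Fintype Cube]
  /-- `above □ = {X ∈ 𝐃_j : X ⊃ □}` -/
  above : Cube → Finset S.Dom
  /-- every localization domain contains at least one cube of `π_j` -/
  exists_cube : ∀ X : S.Dom, ∃ c : Cube, X ∈ above c

/-- `π_j` is a finite family (p. 257 [9]: the torus is compact, the cubes have size `M`); the instance exposes the
field `CubeCover.fin`. [cite: Balaban1987RG1, §0 p.257] -/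
instance CubeCover.instFintypeCube {S : LocDomainSys} (C : CubeCover S) : Fintype C.Cube := C.fin

/-- Re-indexing `Σ_{j=1}^{k} f(k − j) = Σ_{i=0}^{k−1} f(i)` (the substitution behind the last members of (0.26) and
(0.30), where the scale factors are powers of `L^{k−j}`).  Finite sums. [folklore] -/
theorem sum_Icc_one_reflect {β : Type*} [AddCommMonoid β] (f : ℕ → β) (k : ℕ) :
    ∑ j ∈ Finset.Icc 1 k, f (k - j) = ∑ i ∈ Finset.range k, f i := by
  have h := Finset.sum_Ico_reflect f 1 (m := k + 1) (n := k) le_rfl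
  rw [Finset.Ico_add_one_right_eq_Icc, Nat.sub_self, Nat.add_sub_cancel, ← Finset.range_eq_Ico] at h
  exact h

/-- The second member of the chains (0.26)/(0.30), pp. 257–258 [9–10]: *"Σ_{X∈𝐃_j} … ≤ Σ_{□∈π_j} Σ_{X∈𝐃_j, X⊃□} …"* —
regrouping a sum of NONNEGATIVE terms over domains by the cubes they contain (each `X` is counted at least once on
the right because it contains some cube).  Finite combinatorics. [folklore] -/
theorem sum_le_sum_cubes {S : LocDomainSys} (C : CubeCover S) (f : S.Dom → ℝ) (hf : ∀ X, 0 ≤ f X) :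
    ∑ X, f X ≤ ∑ c : C.Cube, ∑ X ∈ C.above c, f X := by
  classical
  have key : ∀ X, f X ≤ ∑ c : C.Cube, (if X ∈ C.above c then f X else 0) := by
    intro X
    obtain ⟨c₀, hc₀⟩ := C.exists_cube X
    calc f X = (if X ∈ C.above c₀ then f X else 0) := by rw [if_pos hc₀]
      _ ≤ ∑ c : C.Cube, (if X ∈ C.above c then f X else 0) :=
          Finset.single_le_sum (f := fun c => if X ∈ C.above c then f X else 0)
            (fun c _ => by
              show 0 ≤ (if X ∈ C.above c then f X else 0)
              split_ifs
              · exact hf X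
              · exact le_rfl)
            (Finset.mem_univ c₀)
  calc ∑ X, f X ≤ ∑ X, ∑ c : C.Cube, (if X ∈ C.above c then f X else 0) :=
        Finset.sum_le_sum fun X _ => key X
    _ = ∑ c : C.Cube, ∑ X, (if X ∈ C.above c then f X else 0) := Finset.sum_comm
    _ = ∑ c : C.Cube, ∑ X ∈ C.above c, f X :=
        Finset.sum_congr rfl fun c _ => Finset.sum_ite_mem_eq (C.above c) f

/-- ONE SCALE of the chains (0.26)/(0.30) (members two to four at fixed `j`, pp. 257–258 [9–10]): if
`|t(X)| ≤ w·exp(−κ d_j(X))` for every `X ∈ 𝐃_j` with `w ≥ 0` (`w = E₀` in (0.26), `w = O(1)(L^jη)^{4+α}` in (0.30)) and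
the tree-decay sums over the domains containing a fixed cube are bounded by `K₀` (the printed "≤ Σ_{□∈π_j} … O(1)";
SILENT INPUT (a) of the section docstring — a hypothesis), then `|Σ_{X∈𝐃_j} t(X)| ≤ w · K₀ · |π_j|`.  Finite sums. [folklore] -/
theorem scale_sum_le {S : LocDomainSys} (C : CubeCover S) {E : Type*} [SeminormedAddCommGroup E]
    (t : S.Dom → E) (w κ K₀ : ℝ) (hw : 0 ≤ w)
    (ht : ∀ X, ‖t X‖ ≤ w * Real.exp (-κ * S.dj X))
    (hK : ∀ c : C.Cube, ∑ X ∈ C.above c, Real.exp (-κ * S.dj X) ≤ K₀) :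
    ‖∑ X, t X‖ ≤ w * K₀ * (Fintype.card C.Cube : ℝ) := by
  calc ‖∑ X, t X‖ ≤ ∑ X, ‖t X‖ := norm_sum_le _ _
    _ ≤ ∑ X, w * Real.exp (-κ * S.dj X) := Finset.sum_le_sum fun X _ => ht X
    _ ≤ ∑ c : C.Cube, ∑ X ∈ C.above c, w * Real.exp (-κ * S.dj X) :=
        sum_le_sum_cubes C _ fun X => mul_nonneg hw (Real.exp_nonneg _)
    _ = ∑ c : C.Cube, w * ∑ X ∈ C.above c, Real.exp (-κ * S.dj X) :=
        Finset.sum_congr rfl fun c _ => (Finset.mul_sum _ _ _).symm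
    _ ≤ ∑ _c : C.Cube, w * K₀ := Finset.sum_le_sum fun c _ => mul_le_mul_of_nonneg_left (hK c) hw
    _ = w * K₀ * (Fintype.card C.Cube : ℝ) := by
        rw [Finset.sum_const, nsmul_eq_mul, Finset.card_univ]; ring

/-- **(0.23)** p. 256 [8], verbatim: *"Thus we obtain after k steps  𝐄_k(U_k) = Σ_{j=1}^{k} [−β_j(g_{j−1}) A^η(U_k) +
𝐄^{(j)}(U_k)]."*  Typed for the values at ONE configuration: `Ek` = 𝐄_k(U_k), `A` = A^η(U_k), `b j` = β_j(g_{j−1}),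
`Etot j` = 𝐄^{(j)}(U_k). [cite: Balaban1987RG1, (0.23) p.256] -/
def Sum023Printed (Ek A : ℝ) (b : ℕ → ℝ) (Etot : ℕ → ℝ) (k : ℕ) : Prop :=
  Ek = ∑ j ∈ Finset.Icc 1 k, (-(b j) * A + Etot j)

/-- **(0.24)** p. 257 [9], verbatim: *"We assume that the functions 𝐄^{(j)}(U), for regular gauge field configurations
U, have the following representation  𝐄^{(j)}(U) = Σ_{X∈𝐃_j} 𝐄^{(j)}(X, U),  where 𝐄^{(j)}(X, U) are analytic and
gauge invariant functions of U, depending on U restricted to X, and satisfying the inequality"* (0.25).  Typed for the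
values at one configuration (`Setup.LocExpansion.total` is the same sum for ℂ-valued functions of complex
configurations; analyticity / gauge invariance / local dependence are §1's (1.18)–(1.19), `Step.SFHyp`). [cite: Balaban1987RG1, (0.24) p.257] -/
def Sum024Printed {S : LocDomainSys} (Etot : ℝ) (EX : S.Dom → ℝ) : Prop :=
  Etot = ∑ X, EX X

/-- **(0.25)** p. 257 [9], verbatim: *"|𝐄^{(j)}(X, U)| ≤ E₀ exp(−κ d_j(X)),  with a sufficiently large constant κ."*
(values at one configuration; `Setup.LocExpansion.ExpDecayBound` is the version on a set of complex configurations). [cite: Balaban1987RG1, (0.25) p.257] -/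
def Bound025Printed {S : LocDomainSys} (EX : S.Dom → ℝ) (E₀ κ : ℝ) : Prop :=
  ∀ X, |EX X| ≤ E₀ * Real.exp (-κ * S.dj X)

/-- **(0.26)** p. 257 [9] — the END MEMBERS of the printed chain, verbatim: *"Let us study implications of the
inequality (0.25). We obtain  |Σ_{j=1}^{k} 𝐄^{(j)}(U_k)| ≤ Σ_{j=1}^{k} Σ_{X∈𝐃_j} E₀ exp(−κd_j(X)) ≤ Σ_{j=1}^{k} Σ_{□∈π_j}
Σ_{X∈𝐃_j,X⊃□} E₀ exp(−κd_j(X)) ≤ Σ_{j=1}^{k} Σ_{□∈π_j} E₀O(1) = Σ_{j=1}^{k} E₀O(1)M^{−4}|T_1^{(j)}| ≤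
E₀O(1)M^{−4}|T_1^{(k)}|η^{−4},  η = L^{−k}."*  p. 258 [10]: *"Of course a bound of this type, with a divergence typical
for a vacuum energy in the four-dimensional space, should be expected, without use of cancellations."*  `Etot j` =
𝐄^{(j)}(U_k), `O1` = the O(1), `Nk` = |T_1^{(k)}|, `η = (L^k)⁻¹`.  (The intermediate members are `chain026_holds`.) [cite: Balaban1987RG1, (0.26) p.257] -/
def Chain026Printed (Etot : ℕ → ℝ) (E₀ O1 M L Nk : ℝ) (k : ℕ) : Prop :=
  |∑ j ∈ Finset.Icc 1 k, Etot j| ≤ E₀ * O1 * M⁻¹ ^ 4 * Nk * ((L ^ k)⁻¹)⁻¹ ^ 4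

/-- **(0.27)** p. 258 [10] (inside the author's sketch, *"Now we sketch it very briefly"*), verbatim: *"Consider a term in
the sum (0.24). If its localization domain X is large, for example it is not contained in any cube □̃, with □ ∈ π_k,
then the inequality (0.25) ensures that  |𝐄^{(j)}(X, U_k)| ≤ E₀ exp(−κ(L^jη)^{−1}) exp(−1/2κd_j(X)),  and the first
exponential can be bounded by an arbitrary positive power of L^jη, e.g. by (5!/κ⁵)(L^jη)⁵."*  "Large" is an ABSTRACT
predicate here (the geometric criterion "not contained in any cube □̃, with □ ∈ π_k" is not modelled, DIVERGENCE F5),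
and the implication from (0.25) (which needs d_j(X) ≥ 2(L^jη)^{−1} for such X) is NOT typed — only the displayed
inequality. [cite: Balaban1987RG1, (0.27) p.258] -/
def Bound027Printed {S : LocDomainSys} (large : S.Dom → Prop) (EX : S.Dom → ℝ) (E₀ κ L η : ℝ) (j : ℕ) : Prop :=
  ∀ X, large X → |EX X| ≤ E₀ * Real.exp (-κ * (L ^ j * η)⁻¹) * Real.exp (-(1 / 2) * κ * S.dj X)

/-- **(0.28)** p. 258 [10], verbatim: *"We define the function β_j(g_{j−1}) to be equal to the coefficient β. Thus we
obtain  −β_j(g_{j−1})A^η(U_k) + 𝐄^{(j)}(U_k) = Σ_{X∈𝐃_j} 𝐕^{(j)}(X, U_k),  where the functions 𝐕^{(j)} satisfy the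
inequalities"* (0.29).  Values at one configuration: `b` = β_j(g_{j−1}), `A` = A^η(U_k), `Etot` = 𝐄^{(j)}(U_k),
`VX X` = 𝐕^{(j)}(X, U_k). [cite: Balaban1987RG1, (0.28) p.258] -/
def Sum028Printed {S : LocDomainSys} (b A Etot : ℝ) (VX : S.Dom → ℝ) : Prop :=
  -b * A + Etot = ∑ X, VX X

/-- **(0.29)** p. 258 [10], verbatim: *"|𝐕^{(j)}(X, U_k)| ≤ O(1)(L^jη)^{4+α} exp(−κd_j(X)),  α > 0,  instead of (0.25)."*
p. 259 [11]: *"Terms satisfying the inequality (0.29) are called irrelevant"*.  `O1` = the O(1) (its INDEPENDENCE of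
j, k, X and of the lattice approximation is the content of "uniform", made explicit by WHERE it is bound in
`uvStable030_of_repr`); `η = L^{−k}`; real exponent `4 + α` (`Real.rpow`).  (`Setup.LocExpansion.IrrelevantBound` is
the version on a set of complex configurations with `s = L^jη`.) [cite: Balaban1987RG1, (0.29) p.258] -/
def Bound029Printed {S : LocDomainSys} (VX : S.Dom → ℝ) (O1 L η α κ : ℝ) (j : ℕ) : Prop :=
  ∀ X, |VX X| ≤ O1 * (L ^ j * η) ^ (4 + α) * Real.exp (-κ * S.dj X)

/-- **(0.30)** p. 258 [10] — the END MEMBERS of the printed chain, verbatim: *"These inequalities yield a uniform bound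
of the sum (0.23) on the lattice T_η, i.e. the only dependence on k is through the volume |T_η| = |T_1^{(k)}|
corresponding to the scale η. Indeed, we have  |𝐄_k(U_k)| ≤ Σ_{j=1}^{k} Σ_{X∈𝐃_j} O(1)(L^jη)^{4+α} exp(−κd_j(X)) ≤
Σ_{j=1}^{k} Σ_{□∈π_j} Σ_{X∈𝐃_j,X⊃□} O(1)(L^jη)^{4+α} exp(−κd_j(X)) ≤ Σ_{j=1}^{k} Σ_{□∈π_j} O(1)(L^jη)^{4+α} =
Σ_{j=1}^{k} O(1)(L^jη)^α M^{−4}|T_1^{(k)}| ≤ O(1)(1 − L^{−α})^{−1} M^{−4}|T_1^{(k)}|."*  p. 259 [11]: *"For the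
effective action corresponding to the unit lattice, where k = K = log_L 1/ε, the above bound is uniform in the
lattice spacing ε. This is the essence of the ultraviolet stability concept"*.  `Ek` = 𝐄_k(U_k), `O1` = the final
O(1), `Nk` = |T_1^{(k)}|; the family version over all runs with ONE constant is `UVStable030` above; the intermediate
members are `chain030_holds`. [cite: Balaban1987RG1, (0.30) p.258] -/
def Chain030Printed (Ek O1 L α M Nk : ℝ) : Prop :=
  |Ek| ≤ O1 * (1 - L ^ (-α))⁻¹ * M⁻¹ ^ 4 * Nk

/-- KERNEL-CHECKED CHAIN **(0.26)** (p. 257 [9]) from its displayed and silent inputs: for scales `j = 1, …, k` with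
domain systems `S j` (= 𝐃_j), cube families `C j` (= π_j), terms `t j X` (= 𝐄^{(j)}(X, U_k)) obeying (0.25) with
`E₀ ≥ 0`, tree-decay sums bounded by `K₀` (silent input (a)), `|π_j| = M⁻⁴ N_j` and `N_j = (L^{k−j})⁴ N_k` (silent
input (b), d = 4; `N_j` = |T_1^{(j)}|), and `L⁴ ≥ 2`: `|Σ_{j=1}^{k} Σ_X t j X| ≤ E₀·K₀·M⁻⁴·N_k·η⁻⁴`, `η = L^{−k}` —
the printed end member with its O(1) = K₀ (the last printed step `Σ_{j=1}^{k} |T_1^{(j)}| ≤ O(1)|T_1^{(k)}|η^{−4}` is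
the geometric sum `Σ_{i=0}^{k−1} (L⁴)^i = ((L⁴)^k − 1)/(L⁴ − 1) ≤ (L⁴)^k` for `L⁴ ≥ 2`; in print L ≥ 2).  Finite
sums; nothing of the series is used. [folklore] -/
theorem chain026_holds (k : ℕ) (S : ℕ → LocDomainSys) (C : (j : ℕ) → CubeCover (S j))
    {E : Type*} [SeminormedAddCommGroup E] (t : (j : ℕ) → (S j).Dom → E)
    (E₀ κ K₀ M L : ℝ) (N : ℕ → ℝ) (hE₀ : 0 ≤ E₀) (hK₀ : 0 ≤ K₀) (hM : 0 < M) (hL : 2 ≤ L ^ 4)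
    (hNk : 0 ≤ N k)
    (h025 : ∀ j ∈ Finset.Icc 1 k, ∀ X, ‖t j X‖ ≤ E₀ * Real.exp (-κ * (S j).dj X))
    (hTree : ∀ j ∈ Finset.Icc 1 k, ∀ c : (C j).Cube, ∑ X ∈ (C j).above c, Real.exp (-κ * (S j).dj X) ≤ K₀)
    (hπ : ∀ j ∈ Finset.Icc 1 k, (Fintype.card (C j).Cube : ℝ) = M⁻¹ ^ 4 * N j)
    (hSites : ∀ j ∈ Finset.Icc 1 k, N j = (L ^ (k - j)) ^ 4 * N k) :
    ‖∑ j ∈ Finset.Icc 1 k, ∑ X, t j X‖ ≤ E₀ * K₀ * M⁻¹ ^ 4 * N k * ((L ^ k)⁻¹)⁻¹ ^ 4 := by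
  have hq0 : (0 : ℝ) ≤ L ^ 4 := le_trans (by norm_num) hL
  -- per-scale bound (members two to four of the chain)
  have step : ∀ j ∈ Finset.Icc 1 k, ‖∑ X, t j X‖ ≤ E₀ * K₀ * M⁻¹ ^ 4 * N k * (L ^ 4) ^ (k - j) := by
    intro j hj
    have h := scale_sum_le (C j) (t j) E₀ κ K₀ hE₀ (h025 j hj) (hTree j hj)
    rw [hπ j hj, hSites j hj, pow_right_comm L (k - j) 4] at h
    calc ‖∑ X, t j X‖ ≤ E₀ * K₀ * (M⁻¹ ^ 4 * ((L ^ 4) ^ (k - j) * N k)) := h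
      _ = E₀ * K₀ * M⁻¹ ^ 4 * N k * (L ^ 4) ^ (k - j) := by ring
  -- the last member: geometric sum `Σ_{j=1}^{k} (L⁴)^{k-j} ≤ (L⁴)^k` for `L⁴ ≥ 2`
  have geom : ∑ j ∈ Finset.Icc 1 k, (L ^ 4) ^ (k - j) ≤ (L ^ 4) ^ k := by
    rw [sum_Icc_one_reflect (fun i => (L ^ 4) ^ i) k]
    have hmul : (∑ i ∈ Finset.range k, (L ^ 4) ^ i) * (L ^ 4 - 1) = (L ^ 4) ^ k - 1 := geom_sum_mul _ k
    have hS : 0 ≤ ∑ i ∈ Finset.range k, (L ^ 4) ^ i := Finset.sum_nonneg fun i _ => pow_nonneg hq0 i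
    have h1 : ∑ i ∈ Finset.range k, (L ^ 4) ^ i ≤ (∑ i ∈ Finset.range k, (L ^ 4) ^ i) * (L ^ 4 - 1) :=
      le_mul_of_one_le_right hS (by linarith)
    linarith
  have hLk : ((L ^ k)⁻¹)⁻¹ ^ 4 = (L ^ 4) ^ k := by rw [inv_inv, pow_right_comm]
  have hconst : 0 ≤ E₀ * K₀ * M⁻¹ ^ 4 * N k := by positivity
  calc ‖∑ j ∈ Finset.Icc 1 k, ∑ X, t j X‖ ≤ ∑ j ∈ Finset.Icc 1 k, ‖∑ X, t j X‖ := norm_sum_le _ _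
    _ ≤ ∑ j ∈ Finset.Icc 1 k, E₀ * K₀ * M⁻¹ ^ 4 * N k * (L ^ 4) ^ (k - j) := Finset.sum_le_sum step
    _ = E₀ * K₀ * M⁻¹ ^ 4 * N k * ∑ j ∈ Finset.Icc 1 k, (L ^ 4) ^ (k - j) := by rw [Finset.mul_sum]
    _ ≤ E₀ * K₀ * M⁻¹ ^ 4 * N k * (L ^ 4) ^ k := mul_le_mul_of_nonneg_left geom hconst
    _ = E₀ * K₀ * M⁻¹ ^ 4 * N k * ((L ^ k)⁻¹)⁻¹ ^ 4 := by rw [hLk]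

/-- (0.26) as printed (`Chain026Printed`, with O(1) = the tree-decay constant `K₀`) from the hypotheses of
`chain026_holds`, for real-valued terms. [folklore] -/
theorem chain026Printed_of (k : ℕ) (S : ℕ → LocDomainSys) (C : (j : ℕ) → CubeCover (S j))
    (t : (j : ℕ) → (S j).Dom → ℝ) (E₀ κ K₀ M L : ℝ) (N : ℕ → ℝ) (hE₀ : 0 ≤ E₀) (hK₀ : 0 ≤ K₀) (hM : 0 < M)
    (hL : 2 ≤ L ^ 4) (hNk : 0 ≤ N k)
    (h025 : ∀ j ∈ Finset.Icc 1 k, Bound025Printed (t j) E₀ κ)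
    (hTree : ∀ j ∈ Finset.Icc 1 k, ∀ c : (C j).Cube, ∑ X ∈ (C j).above c, Real.exp (-κ * (S j).dj X) ≤ K₀)
    (hπ : ∀ j ∈ Finset.Icc 1 k, (Fintype.card (C j).Cube : ℝ) = M⁻¹ ^ 4 * N j)
    (hSites : ∀ j ∈ Finset.Icc 1 k, N j = (L ^ (k - j)) ^ 4 * N k) :
    Chain026Printed (fun j => ∑ X, t j X) E₀ K₀ M L (N k) k := by
  unfold Chain026Printed
  rw [← Real.norm_eq_abs]
  exact chain026_holds k S C t E₀ κ K₀ M L N hE₀ hK₀ hM hL hNk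
    (fun j hj X => by rw [Real.norm_eq_abs]; exact h025 j hj X) hTree hπ hSites

/-- KERNEL-CHECKED CHAIN **(0.30)** (p. 258 [10]) from its displayed and silent inputs: for scales `j = 1, …, k`, terms
`v j X` (= 𝐕^{(j)}(X, U_k)) obeying (0.29) with the SAME `O1 ≥ 0`, `α > 0`, `κ` for all `j` and `η = L^{−k}`, `L > 1`,
tree-decay sums bounded by `K₀` (silent input (a)), `|π_j| = M⁻⁴ N_j` and `N_j = (L^{k−j})⁴ N_k` (silent input (b),
d = 4): `|Σ_{j=1}^{k} Σ_X v j X| ≤ O1·K₀·(1 − L^{−α})^{−1}·M⁻⁴·N_k` — the printed end member of (0.30) with its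
O(1) = O1·K₀.  The fourth member uses `(L^jη)^{4+α}·(L^{k−j})⁴ = (L^jη)^α = (L^{−α})^{k−j}`, the last one the
geometric sum `Σ_{j=1}^{k} (L^{−α})^{k−j} = Σ_{i=0}^{k−1} (L^{−α})^i ≤ (1 − L^{−α})^{−1}`.  Finite sums and real
exponents; nothing of the series is used. [folklore] -/
theorem chain030_holds (k : ℕ) (S : ℕ → LocDomainSys) (C : (j : ℕ) → CubeCover (S j))
    {E : Type*} [SeminormedAddCommGroup E] (v : (j : ℕ) → (S j).Dom → E)
    (O1 α κ K₀ M L : ℝ) (N : ℕ → ℝ) (hO1 : 0 ≤ O1) (hα : 0 < α) (hK₀ : 0 ≤ K₀) (hM : 0 < M) (hL : 1 < L)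
    (hNk : 0 ≤ N k)
    (h029 : ∀ j ∈ Finset.Icc 1 k, ∀ X,
      ‖v j X‖ ≤ O1 * (L ^ j * (L ^ k)⁻¹) ^ (4 + α) * Real.exp (-κ * (S j).dj X))
    (hTree : ∀ j ∈ Finset.Icc 1 k, ∀ c : (C j).Cube, ∑ X ∈ (C j).above c, Real.exp (-κ * (S j).dj X) ≤ K₀)
    (hπ : ∀ j ∈ Finset.Icc 1 k, (Fintype.card (C j).Cube : ℝ) = M⁻¹ ^ 4 * N j)
    (hSites : ∀ j ∈ Finset.Icc 1 k, N j = (L ^ (k - j)) ^ 4 * N k) :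
    ‖∑ j ∈ Finset.Icc 1 k, ∑ X, v j X‖ ≤ O1 * K₀ * (1 - L ^ (-α))⁻¹ * M⁻¹ ^ 4 * N k := by
  have hL0 : 0 < L := lt_trans zero_lt_one hL
  have hq_eq : L ^ (-α) = (L ^ α)⁻¹ := Real.rpow_neg hL0.le α
  have hLα : 1 < L ^ α := Real.one_lt_rpow hL hα
  have hq0 : 0 ≤ L ^ (-α) := by rw [hq_eq]; positivity
  have hq1 : L ^ (-α) < 1 := by rw [hq_eq]; exact inv_lt_one_of_one_lt₀ hLα
  -- the scale factors: `(L^j η)^{4+α} (L^{k-j})^4 = (L^{-α})^{k-j}`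
  have hx : ∀ j ∈ Finset.Icc 1 k,
      (L ^ j * (L ^ k)⁻¹) ^ (4 + α) * (L ^ (k - j)) ^ 4 = (L ^ (-α)) ^ (k - j) := by
    intro j hj
    have hjk : j ≤ k := (Finset.mem_Icc.mp hj).2
    have hy0 : 0 < L ^ (k - j) := pow_pos hL0 _
    have hxeq : L ^ j * (L ^ k)⁻¹ = (L ^ (k - j))⁻¹ := by
      rw [← pow_sub_mul_pow L hjk, mul_inv, mul_comm, mul_assoc, inv_mul_cancel₀ (pow_ne_zero j hL0.ne'),
        mul_one]
    rw [hxeq, Real.rpow_add (inv_pos.mpr hy0), show (4 : ℝ) = ((4 : ℕ) : ℝ) by norm_num, Real.rpow_natCast,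
      inv_pow, mul_comm ((L ^ (k - j)) ^ 4)⁻¹, mul_assoc, inv_mul_cancel₀ (pow_ne_zero 4 hy0.ne'), mul_one,
      Real.inv_rpow hy0.le, ← Real.rpow_natCast_mul hL0.le, mul_comm ((k - j : ℕ) : ℝ) α,
      Real.rpow_mul_natCast hL0.le, hq_eq, inv_pow]
  -- per-scale bound (members two to four of the chain)
  have step : ∀ j ∈ Finset.Icc 1 k, ‖∑ X, v j X‖ ≤ O1 * K₀ * M⁻¹ ^ 4 * N k * (L ^ (-α)) ^ (k - j) := by
    intro j hj
    have hw : 0 ≤ O1 * (L ^ j * (L ^ k)⁻¹) ^ (4 + α) := by positivity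
    have h := scale_sum_le (C j) (v j) _ κ K₀ hw (h029 j hj) (hTree j hj)
    rw [hπ j hj, hSites j hj] at h
    calc ‖∑ X, v j X‖ ≤ O1 * (L ^ j * (L ^ k)⁻¹) ^ (4 + α) * K₀ * (M⁻¹ ^ 4 * ((L ^ (k - j)) ^ 4 * N k)) := h
      _ = O1 * K₀ * M⁻¹ ^ 4 * N k * ((L ^ j * (L ^ k)⁻¹) ^ (4 + α) * (L ^ (k - j)) ^ 4) := by ring
      _ = O1 * K₀ * M⁻¹ ^ 4 * N k * (L ^ (-α)) ^ (k - j) := by rw [hx j hj]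
  -- the last member: geometric sum
  have geom : ∑ j ∈ Finset.Icc 1 k, (L ^ (-α)) ^ (k - j) ≤ (1 - L ^ (-α))⁻¹ := by
    rw [sum_Icc_one_reflect (fun i => (L ^ (-α)) ^ i) k, Finset.range_eq_Ico]
    have h := geom_sum_Ico_le_of_lt_one hq0 hq1 (m := 0) (n := k)
    rw [pow_zero, one_div] at h
    exact h
  have hconst : 0 ≤ O1 * K₀ * M⁻¹ ^ 4 * N k := by positivity
  calc ‖∑ j ∈ Finset.Icc 1 k, ∑ X, v j X‖ ≤ ∑ j ∈ Finset.Icc 1 k, ‖∑ X, v j X‖ := norm_sum_le _ _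
    _ ≤ ∑ j ∈ Finset.Icc 1 k, O1 * K₀ * M⁻¹ ^ 4 * N k * (L ^ (-α)) ^ (k - j) := Finset.sum_le_sum step
    _ = O1 * K₀ * M⁻¹ ^ 4 * N k * ∑ j ∈ Finset.Icc 1 k, (L ^ (-α)) ^ (k - j) := by rw [Finset.mul_sum]
    _ ≤ O1 * K₀ * M⁻¹ ^ 4 * N k * (1 - L ^ (-α))⁻¹ := mul_le_mul_of_nonneg_left geom hconst
    _ = O1 * K₀ * (1 - L ^ (-α))⁻¹ * M⁻¹ ^ 4 * N k := by ring

/-- (0.30) as printed (`Chain030Printed`, with O(1) = `O1·K₀`) from the hypotheses of `chain030_holds`, for real-valued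
terms and `𝐄_k(U_k) = Σ_{j=1}^{k} Σ_{X∈𝐃_j} 𝐕^{(j)}(X, U_k)` ((0.23) with (0.28) inserted). [folklore] -/
theorem chain030Printed_of (k : ℕ) (S : ℕ → LocDomainSys) (C : (j : ℕ) → CubeCover (S j))
    (v : (j : ℕ) → (S j).Dom → ℝ) (Ek O1 α κ K₀ M L : ℝ) (N : ℕ → ℝ) (hO1 : 0 ≤ O1) (hα : 0 < α) (hK₀ : 0 ≤ K₀)
    (hM : 0 < M) (hL : 1 < L) (hNk : 0 ≤ N k)
    (hEk : Ek = ∑ j ∈ Finset.Icc 1 k, ∑ X, v j X)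
    (h029 : ∀ j ∈ Finset.Icc 1 k, Bound029Printed (v j) O1 L ((L ^ k)⁻¹) α κ j)
    (hTree : ∀ j ∈ Finset.Icc 1 k, ∀ c : (C j).Cube, ∑ X ∈ (C j).above c, Real.exp (-κ * (S j).dj X) ≤ K₀)
    (hπ : ∀ j ∈ Finset.Icc 1 k, (Fintype.card (C j).Cube : ℝ) = M⁻¹ ^ 4 * N j)
    (hSites : ∀ j ∈ Finset.Icc 1 k, N j = (L ^ (k - j)) ^ 4 * N k) :
    Chain030Printed Ek (O1 * K₀) L α M (N k) := by
  unfold Chain030Printed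
  rw [hEk, ← Real.norm_eq_abs]
  exact chain030_holds k S C v O1 α κ K₀ M L N hO1 hα hK₀ hM hL hNk
    (fun j hj X => by rw [Real.norm_eq_abs]; exact h029 j hj X) hTree hπ hSites

/-- p. 258 [10], verbatim: *"These inequalities yield a uniform bound of the sum (0.23) on the lattice T_η, i.e. the
only dependence on k is through the volume |T_η| = |T_1^{(k)}| corresponding to the scale η."* — as an implication at
the level of `RunData`: IF along every run with `0 < g_k ≤ γ` the representation `Repr k` holds for `k ≤ K` (the
conclusion of Theorem 1 / Theorem 3) and `Repr k` MEANS, for the run's §0 term data (`S P j` = 𝐃_j, `π P j` = π_j,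
`Etot P k V j` = 𝐄^{(j)}(U_k(V)), `VX P k V j X` = 𝐕^{(j)}(X, U_k(V))), the identities (0.23), (0.28) and the bound
(0.29) with constants `O1, α, κ` chosen BEFORE the run (this placement is the word "uniform"), and IF the silent
inputs hold — (a) tree-decay sums `≤ K₀`, (b) `|π_j| = M⁻⁴|T_1^{(j)}|` and `|T_1^{(j)}| = L^{4(k−j)}|T_1^{(k)}|` for
`j ≤ k ≤ K` — THEN `UVStable030 C γ (O1·K₀·(1 − L^{−α})^{−1}) M`, i.e. (0.30) with one constant for all runs, hence
*"uniform in the lattice spacing ε"* (p. 259 [11]).  Bookkeeping over `chain030_holds`; the hypotheses are displayed,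
not discharged — (0.24)–(0.29) for the actual expansion are Theorem 3 / §§2–5 + [Balaban1988RG2Cluster]. [folklore] -/
theorem uvStable030_of_repr (C : Construction) (γ O1 α κ K₀ M L : ℝ)
    (hO1 : 0 ≤ O1) (hα : 0 < α) (hK₀ : 0 ≤ K₀) (hM : 0 < M) (hL : 1 < L)
    (S : RunParams → ℕ → LocDomainSys) (π : (P : RunParams) → (j : ℕ) → CubeCover (S P j))
    (Etot : (P : RunParams) → (k : ℕ) → (C P).Cfg k → ℕ → ℝ)
    (VX : (P : RunParams) → (k : ℕ) → (C P).Cfg k → (j : ℕ) → (S P j).Dom → ℝ)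
    (hRepr : ∀ P : RunParams, (C P).flow.InInterval γ P.K → ∀ k, k ≤ P.K → (C P).Repr k)
    (h023 : ∀ P k, (C P).Repr k → ∀ V, V ∈ (C P).dom k →
      Sum023Printed ((C P).Ek k V) ((C P).wilsonBG k V) (fun j => (C P).flow.β j ((C P).flow.g (j - 1)))
        (Etot P k V) k)
    (h028 : ∀ P k, (C P).Repr k → ∀ V, V ∈ (C P).dom k → ∀ j ∈ Finset.Icc 1 k,
      Sum028Printed ((C P).flow.β j ((C P).flow.g (j - 1))) ((C P).wilsonBG k V) (Etot P k V j) (VX P k V j))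
    (h029 : ∀ P k, (C P).Repr k → ∀ V, V ∈ (C P).dom k → ∀ j ∈ Finset.Icc 1 k,
      Bound029Printed (VX P k V j) O1 L ((L ^ k)⁻¹) α κ j)
    (hTree : ∀ P j (c : (π P j).Cube), ∑ X ∈ (π P j).above c, Real.exp (-κ * (S P j).dj X) ≤ K₀)
    (hπ : ∀ P j, (Fintype.card (π P j).Cube : ℝ) = M⁻¹ ^ 4 * ((C P).numSites j : ℝ))
    (hSites : ∀ P j k, j ≤ k → k ≤ P.K →
      ((C P).numSites j : ℝ) = (L ^ (k - j)) ^ 4 * ((C P).numSites k : ℝ)) :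
    UVStable030 C γ (O1 * K₀ * (1 - L ^ (-α))⁻¹) M := by
  intro P hP k hk V hV
  have hR : (C P).Repr k := hRepr P hP k hk
  have hsum : (C P).Ek k V = ∑ j ∈ Finset.Icc 1 k, ∑ X, VX P k V j X := by
    have e : (C P).Ek k V = _ := h023 P k hR V hV
    rw [e]
    exact Finset.sum_congr rfl fun j hj => h028 P k hR V hV j hj
  rw [hsum, ← Real.norm_eq_abs]
  exact chain030_holds k (S P) (π P) (fun j => VX P k V j) O1 α κ K₀ M L (fun j => ((C P).numSites j : ℝ))
    hO1 hα hK₀ hM hL (Nat.cast_nonneg _)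
    (fun j hj X => by rw [Real.norm_eq_abs]; exact h029 P k hR V hV j hj X)
    (fun j _ => hTree P j) (fun j _ => hπ P j)
    (fun j hj => hSites P j k (Finset.mem_Icc.mp hj).2 hk)

/-- `Thm1Printed` ⇒ ultraviolet stability (0.30)/`UVStable030` with the SAME γ, under the reading of `Repr` and the
silent inputs displayed in `uvStable030_of_repr` (p. 258 [10] "These inequalities yield a uniform bound …"; p. 259 [11]
"This is the essence of the ultraviolet stability concept").  Pure logic over `uvStable030_of_repr`. [folklore] -/
theorem uvStable030_of_thm1 (C : Construction) (O1 α κ K₀ M L : ℝ)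
    (hO1 : 0 ≤ O1) (hα : 0 < α) (hK₀ : 0 ≤ K₀) (hM : 0 < M) (hL : 1 < L)
    (S : RunParams → ℕ → LocDomainSys) (π : (P : RunParams) → (j : ℕ) → CubeCover (S P j))
    (Etot : (P : RunParams) → (k : ℕ) → (C P).Cfg k → ℕ → ℝ)
    (VX : (P : RunParams) → (k : ℕ) → (C P).Cfg k → (j : ℕ) → (S P j).Dom → ℝ)
    (h1 : Thm1Printed C)
    (h023 : ∀ P k, (C P).Repr k → ∀ V, V ∈ (C P).dom k →
      Sum023Printed ((C P).Ek k V) ((C P).wilsonBG k V) (fun j => (C P).flow.β j ((C P).flow.g (j - 1)))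
        (Etot P k V) k)
    (h028 : ∀ P k, (C P).Repr k → ∀ V, V ∈ (C P).dom k → ∀ j ∈ Finset.Icc 1 k,
      Sum028Printed ((C P).flow.β j ((C P).flow.g (j - 1))) ((C P).wilsonBG k V) (Etot P k V j) (VX P k V j))
    (h029 : ∀ P k, (C P).Repr k → ∀ V, V ∈ (C P).dom k → ∀ j ∈ Finset.Icc 1 k,
      Bound029Printed (VX P k V j) O1 L ((L ^ k)⁻¹) α κ j)
    (hTree : ∀ P j (c : (π P j).Cube), ∑ X ∈ (π P j).above c, Real.exp (-κ * (S P j).dj X) ≤ K₀)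
    (hπ : ∀ P j, (Fintype.card (π P j).Cube : ℝ) = M⁻¹ ^ 4 * ((C P).numSites j : ℝ))
    (hSites : ∀ P j k, j ≤ k → k ≤ P.K →
      ((C P).numSites j : ℝ) = (L ^ (k - j)) ^ 4 * ((C P).numSites k : ℝ)) :
    ∃ γ : ℝ, 0 < γ ∧ UVStable030 C γ (O1 * K₀ * (1 - L ^ (-α))⁻¹) M := by
  obtain ⟨γ, hγ, hRepr⟩ := h1
  exact ⟨γ, hγ, uvStable030_of_repr C γ O1 α κ K₀ M L hO1 hα hK₀ hM hL S π Etot VX hRepr h023 h028 h029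
    hTree hπ hSites⟩

/-! ## Surge nodes (2) — p. 258 [10], §3 pp. 270–272 [22–24], p. 281 [33]: irrelevance of the LARGE-DOMAIN terms
from the bound (1.18)/(0.25), and the shape of Theorem 3 as "a precise version of Theorem 1" (p. 264 [16])
(surge node T09.3 SHARPEN, unit b2b-balaban-pv03, 2026-08-18)

Printed inputs, verbatim.  p. 258 [10]: *"If its localization domain X is large, for example it is not contained in
any cube □̃, with □ ∈ π_k, then the inequality (0.25) ensures that [(0.27)], and the first exponential can be bounded
by an arbitrary positive power of L^jη, e.g. by (5!/κ⁵)(L^jη)⁵. This power is enough to control the sums in (0.23),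
(0.24)."*  p. 271 [23]: *"In the second case X is a big domain in ξ-scale, for example d_j(X) ≥ (L^jη)^{−1}. Thus
either the exponential decay of propagators corresponding to ξ-scale, or the exponential bound (1.18) should give a
small factor O((L^jη)^N) with an arbitrary power N, enough to control the sums."*  p. 272 [24]: *"In the second,
simpler case, we obtain the exponential factor exp(−δκ(L^jη)^{−1}) directly from the bound (1.18), here δ is a
small, positive number. The remaining factor exp(−(1−δ)κd_j(X)) from the bound (1.18) will be used in a proof of the
inductive assumptions for new terms. Thus in both cases we have irrelevant terms."*

What is KERNEL-CHECKED here is exactly this elementary "second, simpler case": `exp(−x) ≤ N!/x^N` (the "(5!/κ⁵)(L^jη)⁵"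
of p. 258, every N), the δ-split of p. 272, and their combination `largeDomain_bound` / `bound029_of_025_large`: a
family satisfying (0.25) = (1.18) with rate κ satisfies, ON THE DOMAINS WITH d_j(X) ≥ (L^jη)^{−1}, the irrelevance bound
(0.29) with exponent 4 + α = N (any N ≥ 5), constant O(1) = E₀·N!/(δκ)^N and rate (1 − δ)κ.  The "first case" of p. 271
(X far from the cube: decay of propagators, (3.6)–(3.9), Proposition 9 of [Balaban1985Variational]) and the SMALL-DOMAIN
terms (X ⊂ □̃²: the expansion (3.10)–(3.34), the Ward–Takahashi identities of §4 and the β-function extraction of §5)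
are the substance of the paper and are NOT touched; they remain the located hypothesis `hExtract` of
`thm1_of_thm3_twoStage` below (GAPS.md G-pv03-2).  Numbering: §3 (pp. 270, 281) calls the irrelevance bound "(0.28)";
in §0 as printed it is (0.29) and (0.28) is the representation (DIVERGENCE.md D-pv03.4); the typed target is (0.29). -/

open scoped Nat

/-- The elementary inequality behind p. 258 [10] *"the first exponential can be bounded by an arbitrary positive power
of L^jη, e.g. by (5!/κ⁵)(L^jη)⁵"* and p. 271 [23] *"a small factor O((L^jη)^N) with an arbitrary power N"*, in the
variables of p. 272 [24]: with `c` = δκ and `s` = L^jη,  `exp(−δκ(L^jη)^{−1}) ≤ (N!/(δκ)^N)·(L^jη)^N` (for N = 5, δ = 1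
this is the printed "(5!/κ⁵)(L^jη)⁵").  From `x^N/N! ≤ exp x` (`Real.pow_div_factorial_le_exp`); the bare form
`exp(−x) ≤ N!/x^N` already sits in the tree as `Literature.Computability.Complexity.GoldwasserSipser.exp_neg_le_factorial_div_pow`
(not imported here — cross-topic — and re-derived inline in three lines). [cite: Balaban1987RG1, p.258 and p.272] -/
theorem exp_neg_inv_le_pow {c s : ℝ} (hc : 0 < c) (hs : 0 < s) (N : ℕ) :
    Real.exp (-(c * s⁻¹)) ≤ (N ! : ℝ) / c ^ N * s ^ N := by
  have hx : 0 < c * s⁻¹ := mul_pos hc (inv_pos.mpr hs)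
  have h : Real.exp (-(c * s⁻¹)) ≤ (N ! : ℝ) / (c * s⁻¹) ^ N := by
    have hle : (c * s⁻¹) ^ N / (N ! : ℝ) ≤ Real.exp (c * s⁻¹) :=
      Real.pow_div_factorial_le_exp (hx := hx.le) (n := N)
    have hpos : 0 < (c * s⁻¹) ^ N / (N ! : ℝ) := by positivity
    calc Real.exp (-(c * s⁻¹)) = (Real.exp (c * s⁻¹))⁻¹ := Real.exp_neg _
      _ ≤ ((c * s⁻¹) ^ N / (N ! : ℝ))⁻¹ := inv_anti₀ hpos hle
      _ = (N ! : ℝ) / (c * s⁻¹) ^ N := inv_div _ _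
  have hs' : s ≠ 0 := ne_of_gt hs
  have hc' : c ≠ 0 := ne_of_gt hc
  calc Real.exp (-(c * s⁻¹)) ≤ (N ! : ℝ) / (c * s⁻¹) ^ N := h
    _ = (N ! : ℝ) / c ^ N * s ^ N := by
        rw [mul_pow, inv_pow]
        field_simp

/-- The δ-split of p. 272 [24], verbatim: *"we obtain the exponential factor exp(−δκ(L^jη)^{−1}) directly from the
bound (1.18), here δ is a small, positive number. The remaining factor exp(−(1−δ)κd_j(X)) from the bound (1.18) will
be used in a proof of the inductive assumptions for new terms"*: for `R ≤ d` (R = (L^jη)^{−1}, d = d_j(X)), `δ, κ ≥ 0`,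
`exp(−κd) ≤ exp(−δκR)·exp(−(1−δ)κd)`. [cite: Balaban1987RG1, p.272] -/
theorem exp_decay_split {κ δ d R : ℝ} (hδ : 0 ≤ δ) (hκ : 0 ≤ κ) (hRd : R ≤ d) :
    Real.exp (-κ * d) ≤ Real.exp (-(δ * κ) * R) * Real.exp (-((1 - δ) * κ) * d) := by
  have hsplit : Real.exp (-κ * d) = Real.exp (-(δ * κ) * d) * Real.exp (-((1 - δ) * κ) * d) := by
    rw [← Real.exp_add]; ring_nf
  rw [hsplit]
  have hδκ : 0 ≤ δ * κ := mul_nonneg hδ hκ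
  have h1 : Real.exp (-(δ * κ) * d) ≤ Real.exp (-(δ * κ) * R) :=
    Real.exp_le_exp.mpr (by nlinarith)
  exact mul_le_mul_of_nonneg_right h1 (Real.exp_pos _).le

/-- THE "SECOND, SIMPLER CASE" of p. 271–272 [23–24] combined with p. 258 [10]: a term obeying the (1.18)/(0.25) bound
`|E| ≤ E₀ exp(−κ d_j(X))` on a domain with `d_j(X) ≥ (L^jη)^{−1}` obeys, for every `N` and every `δ > 0` (the
inequality needs no upper bound on δ; `δ < 1` only keeps the residual rate (1−δ)κ positive, as in print),
`|E| ≤ E₀ · (N!/(δκ)^N) · (L^jη)^N · exp(−(1−δ)κ d_j(X))` — an irrelevance bound of the form (0.29) with 4 + α = N,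
O(1) = E₀N!/(δκ)^N and rate (1−δ)κ (p. 272: "Thus in both cases we have irrelevant terms").  `s` = L^jη > 0.
Re-derived and kernel-checked; the printed text gives the two factors, not the bookkeeping. [cite: Balaban1987RG1, pp.271–272 and p.258] -/
theorem largeDomain_bound {E E₀ κ δ d s : ℝ} (N : ℕ) (hE : |E| ≤ E₀ * Real.exp (-κ * d)) (hE₀ : 0 ≤ E₀)
    (hκ : 0 < κ) (hδ : 0 < δ) (hs : 0 < s) (hd : s⁻¹ ≤ d) :
    |E| ≤ E₀ * ((N ! : ℝ) / (δ * κ) ^ N) * s ^ N * Real.exp (-((1 - δ) * κ) * d) := by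
  have h1 : Real.exp (-κ * d) ≤ Real.exp (-(δ * κ) * s⁻¹) * Real.exp (-((1 - δ) * κ) * d) :=
    exp_decay_split hδ.le hκ.le hd
  have h2 : Real.exp (-(δ * κ) * s⁻¹) ≤ (N ! : ℝ) / (δ * κ) ^ N * s ^ N := by
    have := exp_neg_inv_le_pow (mul_pos hδ hκ) hs N
    simpa [neg_mul] using this
  have h3 : Real.exp (-κ * d) ≤ (N ! : ℝ) / (δ * κ) ^ N * s ^ N * Real.exp (-((1 - δ) * κ) * d) :=
    le_trans h1 (mul_le_mul_of_nonneg_right h2 (Real.exp_pos _).le)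
  calc |E| ≤ E₀ * Real.exp (-κ * d) := hE
    _ ≤ E₀ * ((N ! : ℝ) / (δ * κ) ^ N * s ^ N * Real.exp (-((1 - δ) * κ) * d)) :=
        mul_le_mul_of_nonneg_left h3 hE₀
    _ = E₀ * ((N ! : ℝ) / (δ * κ) ^ N) * s ^ N * Real.exp (-((1 - δ) * κ) * d) := by ring

/-- A family bound of type (0.25) forces `E₀ ≥ 0` as soon as the family is indexed by a nonempty type (|·| ≥ 0 and
exp > 0) — bookkeeping used below. [folklore] -/
theorem E₀_nonneg_of_bound025 {S : LocDomainSys} {EX : S.Dom → ℝ} {E₀ κ : ℝ} (h025 : Bound025Printed EX E₀ κ)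
    (X : S.Dom) : 0 ≤ E₀ := by
  have h := le_trans (abs_nonneg (EX X)) (h025 X)
  exact (mul_nonneg_iff_of_pos_right (Real.exp_pos _)).mp h

/-- (0.25) ⟹ (0.27) AS PRINTED (p. 258 [10]), for the domains on which `d_j(X) ≥ 2(L^jη)^{−1}`:
`exp(−κd) = exp(−κd/2)·exp(−κd/2) ≤ exp(−κ(L^jη)^{−1})·exp(−(1/2)κd)`.  The printed criterion for "large" ("not
contained in any cube □̃, with □ ∈ π_k") is geometric and stays the abstract predicate `large` of `Bound027Printed`;
what is checked is the implication under the stated lower bound on d_j (DIVERGENCE.md D-pv03.1: with only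
`d_j(X) > (L^jη)^{−1}` one gets half κ in BOTH factors, i.e. `largeDomain_bound` with δ = 1/2, N arbitrary). [cite: Balaban1987RG1, (0.25) p.257 and (0.27) p.258] -/
theorem bound027_of_025 {S : LocDomainSys} (large : S.Dom → Prop) (EX : S.Dom → ℝ) (E₀ κ L η : ℝ) (j : ℕ)
    (hκ : 0 ≤ κ) (h025 : Bound025Printed EX E₀ κ)
    (hlarge : ∀ X, large X → 2 * (L ^ j * η)⁻¹ ≤ S.dj X) :
    Bound027Printed large EX E₀ κ L η j := by
  intro X hX
  have hE₀ : 0 ≤ E₀ := E₀_nonneg_of_bound025 h025 X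
  have hd := hlarge X hX
  have hsplit : Real.exp (-κ * S.dj X)
      = Real.exp (-(1 / 2) * κ * S.dj X) * Real.exp (-(1 / 2) * κ * S.dj X) := by
    rw [← Real.exp_add]; ring_nf
  have h1 : Real.exp (-(1 / 2) * κ * S.dj X) ≤ Real.exp (-κ * (L ^ j * η)⁻¹) :=
    Real.exp_le_exp.mpr (by nlinarith)
  calc |EX X| ≤ E₀ * Real.exp (-κ * S.dj X) := h025 X
    _ = E₀ * (Real.exp (-(1 / 2) * κ * S.dj X) * Real.exp (-(1 / 2) * κ * S.dj X)) := by rw [hsplit]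
    _ ≤ E₀ * (Real.exp (-κ * (L ^ j * η)⁻¹) * Real.exp (-(1 / 2) * κ * S.dj X)) :=
        mul_le_mul_of_nonneg_left (mul_le_mul_of_nonneg_right h1 (Real.exp_pos _).le) hE₀
    _ = E₀ * Real.exp (-κ * (L ^ j * η)⁻¹) * Real.exp (-(1 / 2) * κ * S.dj X) := by ring

/-- (0.25)/(1.18) ⟹ (0.29) FOR THE LARGE-DOMAIN PART OF THE FAMILY (p. 271–272 "second, simpler case" + p. 258), in
the shape `Bound029Printed`: the family `X ↦ 𝐄^{(j)}(X, U_k)` restricted to the domains with `d_j(X) ≥ (L^jη)^{−1}`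
(zero elsewhere) satisfies (0.29) with exponent `4 + α`, `α = N − 4` for EVERY `N` (take `N ≥ 5` for the `α > 0`
that (0.29) requires — the "5!" of p. 258), constant `O(1) = E₀·N!/(δκ)^N` and decay rate `(1 − δ)κ`.  Hypotheses displayed: `0 < κ`, `0 < δ` (print: "δ is
a small, positive number"; δ < 1 keeps the rate positive but is not needed for the inequality), `0 < L^jη`.  The complementary small-domain part (X inside a cube □̃²) is §§3–5 of the paper and is NOT derived here. [cite: Balaban1987RG1, pp.271–272, p.258, (0.29) p.258] -/
theorem bound029_of_025_large {S : LocDomainSys} (large : S.Dom → Prop) [DecidablePred large] (EX : S.Dom → ℝ)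
    (E₀ κ δ L η : ℝ) (j N : ℕ) (h025 : Bound025Printed EX E₀ κ)
    (hκ : 0 < κ) (hδ : 0 < δ) (hs : 0 < L ^ j * η)
    (hlarge : ∀ X, large X → (L ^ j * η)⁻¹ ≤ S.dj X) :
    Bound029Printed (fun X => if large X then EX X else 0) (E₀ * ((N ! : ℝ) / (δ * κ) ^ N)) L η ((N : ℝ) - 4)
      ((1 - δ) * κ) j := by
  intro X
  have hpow : (L ^ j * η) ^ ((4 : ℝ) + ((N : ℝ) - 4)) = (L ^ j * η) ^ N := by
    rw [show (4 : ℝ) + ((N : ℝ) - 4) = (N : ℝ) by ring, Real.rpow_natCast]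
  rw [hpow]
  dsimp only
  by_cases hX : large X
  · rw [if_pos hX]
    have hE₀ : 0 ≤ E₀ := E₀_nonneg_of_bound025 h025 X
    have h := largeDomain_bound (E := EX X) (d := S.dj X) N (h025 X) hE₀ hκ hδ hs (hlarge X hX)
    simpa [mul_assoc, mul_comm, mul_left_comm] using h
  · rw [if_neg hX, abs_zero]
    have hE₀ : 0 ≤ E₀ := E₀_nonneg_of_bound025 h025 X
    positivity

/-- THEOREM 3 AS "a precise version of Theorem 1" (p. 264 [16]), with the inclusion `IndAss k → Repr k` of
`thm1_of_thm3_fixedConsts` UNPACKED into its two printed stages: (1) INSPECTION — the inductive assumptions (1.1)–(1.22)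
at step k contain the representation (1.6)/(1.7) = (0.22)–(0.24) with the bounds (1.18) = (0.25) on the complex spaces
U^c_j(X, α₀, α₁) (p. 260–263); (2) EXTRACTION — from (1.18) + analyticity to the irrelevant representation (0.28) with
(0.29): the two-case argument of §3 (p. 271 (3.5): large domains, p. 271–272, the "second, simpler case" being
`largeDomain_bound` above; small domains X ⊂ □̃²: the expansion (3.10)–(3.34), §4 Ward–Takahashi identities, §5), p. 281:
*"The remaining terms are irrelevant according to our terminology, i.e. they satisfy bounds of the form (0.28) [sic,
= (0.29)] on their domains of analyticity."*  `Mid P k` = the stage-(1) content at step k (abstract, like `Repr`,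
`IndAss`).  Pure logic; its value is to LOCATE stage (2) as a hypothesis (GAPS.md G-pv03-2), which is NOT an
inspection. [folklore] -/
theorem thm1_of_thm3_twoStage (C : Consts3 → Construction) (c : Consts3) (γ : ℝ) (hγ : 0 < γ)
    (h3 : ∀ P : RunParams, (C c P).flow.InInterval γ P.K → ∀ k, k ≤ P.K → (C c P).IndAss k)
    (Mid : RunParams → ℕ → Prop)
    (hInspect : ∀ P k, (C c P).IndAss k → Mid P k)
    (hExtract : ∀ P k, k ≤ P.K → (C c P).flow.InInterval γ P.K → Mid P k → (C c P).Repr k) :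
    Thm1Printed (C c) :=
  ⟨γ, hγ, fun P hP k hk => hExtract P k hk hP (hInspect P k (h3 P hP k hk))⟩
end Literature.MathematicalPhysics.QuantumFieldTheory.Balaban1983to89.B12
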